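import Mathlib.Analysis.InnerProductSpace.PiL2
import Mathlib.Analysis.SpecialFunctions.Pow.Real
import HarnessLib

/-!
# The soft unit octahedron lemma (`stub_octahedron` of the line `birth`)
# (route `HullExactificationCascade`, crux `ZeroDefectDensity`, stmt-AtomisticToContinuum-12086)

In the rigidity step of the line, the centre `u` of a softly twelve-kissed shell, a square face
`z₁ z₂ z₃ z₄` of its (anti)cuboctahedral shell and the cap atom `w` above that square span an
octahedron all of whose twelve edges are soft contacts (lengths in `[1-η, 1+η]`, `η ≤ 1/1000`)
while the three diagonals `z₁z₃`, `z₂z₄`, `uw` are non-contacts (`≥ 1.31` by the gap).  The lemma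
`stub_octahedron` (verbatim the registered stub signature) pins the three diagonals to
`√2 ± 30η`, killing the jitterbug flex of the bare cuboctahedron.

Proof (elementary, no angles).  Put `v = (w-u)/2`, `aᵢ = zᵢ - (u+w)/2`.
* `oct_apex`, `oct_edge`: Apollonius turns the apex edges into `|⟪aᵢ,v⟫| ≤ η`,
  `‖aᵢ‖² + ‖v‖² ∈ [(1-η)², (1+η)²]`, and the equator edges into bounds on `⟪aᵢ, aᵢ₊₁⟫`; hence
  `s = a₁ + a₃` has `O(η)` inner product with `D = a₁ - a₃`, `D' = a₂ - a₄` and `v`.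
* `oct_frame3`: three-dimensionality enters once, as the polarised Lagrange identity for the
  frame `(v, D, v × D)` (proved in coordinates by `ring`); `oct_solve_frame` turns it into
  `‖s‖² ≤ 121 η²` by real arithmetic.
* `oct_solve_H`: Cauchy–Schwarz on `⟪s, a₂⟫ = ⟪a₁,a₂⟫ + ⟪a₂,a₃⟫ ≈ 1 - 2‖v‖²` pins
  `|4‖v‖² - 2| ≤ 29η`; `oct_solve_D`: the parallelogram law pins `‖D‖² = 2 ± 38η`;
  `oct_abs_sub_sqrt_two_le` converts to `|· - √2| ≤ 30η` (intermediate constants `≈ 11η` for the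
  axis and `≈ 14η` for the equator diagonals; `30η` is what is registered and concluded).
* `oct_core13v` / `oct_core13` assemble one equator diagonal and the axis; `stub_octahedron`
  applies it twice (cyclic relabelling `z₁z₂z₃z₄ ↦ z₂z₃z₄z₁`).
-/

noncomputable section

namespace Summit.AtomisticToContinuum.Crystallization.Theorems.ZeroDefectDensityBirth

open RealInnerProductSpace

/-- The real-arithmetic heart of the soft octahedron lemma ("a vector nearly orthogonal to a
nearly orthogonal frame of `ℝ³` is short"): the three frame identities `hE1`–`hE3` (instances of
`oct_frame3` for the pairs `(s,s)`, `(D',D')`, `(s,D')` against the frame `(v, D, v × D)`, with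
unknown components `A = ⟪s, v × D⟫`, `B = ⟪D', v × D⟫`), together with the smallness of all
mixed Gram entries, force `‖s‖² = S2 ≤ 121 η²`. [folklore] -/
theorem oct_solve_frame {e H P P' S2 sD sv vD D'v σ τ A B : ℝ} (he0 : 0 ≤ e) (he : e ≤ 1 / 1000)
    (hH : 0.429 ≤ H) (hH' : H ≤ 1.003) (hP : 1.7161 ≤ P) (hP2 : P ≤ 2.3) (hP' : 1.7161 ≤ P')
    (hsD : |sD| ≤ 4 * e) (hsv : |sv| ≤ 2 * e) (hvD : |vD| ≤ 2 * e) (hD'v : |D'v| ≤ 2 * e)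
    (hσ : |σ| ≤ 12 * e) (hτ : |τ| ≤ 12 * e)
    (hE1 : (H * P - vD ^ 2) * S2 =
      A * A + H * (sD * sD) - vD * (sD * sv + sv * sD) + P * (sv * sv))
    (hE2 : (H * P - vD ^ 2) * P' =
      B * B + H * (τ * τ) - vD * (τ * D'v + D'v * τ) + P * (D'v * D'v))
    (hE3 : (H * P - vD ^ 2) * σ =
      A * B + H * (sD * τ) - vD * (sD * D'v + sv * τ) + P * (sv * D'v)) :
    S2 ≤ 121 * e ^ 2 := by
  -- `|x y| ≤ a b` from `|x| ≤ a`, `|y| ≤ b` (cf. `abs_mul_le_of_le` in the FluidPDE literature)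
  have oct_abs_mul_le : ∀ {x y a b : ℝ}, |x| ≤ a → |y| ≤ b → |x * y| ≤ a * b :=
    fun hx hy => (abs_mul _ _).trans_le (mul_le_mul hx hy (abs_nonneg _) ((abs_nonneg _).trans hx))
  have he2 : e * e ≤ 1 / 1000 * e := mul_le_mul_of_nonneg_right he he0
  have he3 : e * (e * e) ≤ 1 / 1000 * (e * e) := mul_le_mul_of_nonneg_right he (mul_self_nonneg e)
  have hHa : |H| ≤ 1.003 := by rw [abs_of_nonneg (by linarith)]; exact hH'
  have hPa : |P| ≤ 2.3 := by rw [abs_of_nonneg (by linarith)]; exact hP2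
  have hvD2 : vD ^ 2 ≤ (2 * e) ^ 2 := sq_le_sq' (abs_le.mp hvD).1 (abs_le.mp hvD).2
  have hHP : 0.429 * 1.7161 ≤ H * P := mul_le_mul hH hP (by norm_num) (by linarith)
  -- the frame Gram determinant
  set G := H * P - vD ^ 2 with hG
  have hG0 : 0.736 ≤ G := by rw [hG]; linarith
  have hGpos : 0 < G := by linarith
  -- the three remainders
  obtain ⟨r11, r11'⟩ := abs_le.mp (oct_abs_mul_le hHa (oct_abs_mul_le hsD hsD))
  obtain ⟨r12, r12'⟩ := abs_le.mp (oct_abs_mul_le hvD (oct_abs_mul_le hsD hsv))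
  obtain ⟨r13, r13'⟩ := abs_le.mp (oct_abs_mul_le hPa (oct_abs_mul_le hsv hsv))
  obtain ⟨r21, r21'⟩ := abs_le.mp (oct_abs_mul_le hHa (oct_abs_mul_le hτ hτ))
  obtain ⟨r22, r22'⟩ := abs_le.mp (oct_abs_mul_le hvD (oct_abs_mul_le hτ hD'v))
  obtain ⟨r23, r23'⟩ := abs_le.mp (oct_abs_mul_le hPa (oct_abs_mul_le hD'v hD'v))
  obtain ⟨r31, r31'⟩ := abs_le.mp (oct_abs_mul_le hHa (oct_abs_mul_le hsD hτ))
  obtain ⟨r32, r32'⟩ := abs_le.mp (oct_abs_mul_le hvD (oct_abs_mul_le hsD hD'v))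
  obtain ⟨r33, r33'⟩ := abs_le.mp (oct_abs_mul_le hvD (oct_abs_mul_le hsv hτ))
  obtain ⟨r34, r34'⟩ := abs_le.mp (oct_abs_mul_le hPa (oct_abs_mul_le hsv hD'v))
  have E1' : G * S2 = A * A + (H * (sD * sD) - 2 * (vD * (sD * sv)) + P * (sv * sv)) := by
    rw [hE1]; ring
  have E2' : B * B = G * P' - (H * (τ * τ) - 2 * (vD * (τ * D'v)) + P * (D'v * D'v)) := by
    rw [hE2]; ring
  have E3' : A * B =
      G * σ - (H * (sD * τ) - vD * (sD * D'v) - vD * (sv * τ) + P * (sv * D'v)) := by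
    rw [hE3]; ring
  -- `B² ≳ 1.7158 G`
  have hGP' : G * 1.7161 ≤ G * P' := mul_le_mul_of_nonneg_left hP' hGpos.le
  have hB2 : 1.7158 * G ≤ B * B := by rw [E2']; linarith
  -- `|A B| ≲ 12.08 η G`
  obtain ⟨hσ1, hσ2⟩ := abs_le.mp hσ
  have hGσ1 : G * σ ≤ G * (12 * e) := mul_le_mul_of_nonneg_left hσ2 hGpos.le
  have hGσ2 : G * (-(12 * e)) ≤ G * σ := mul_le_mul_of_nonneg_left hσ1 hGpos.le
  have heG : 0.736 * e ≤ G * e := mul_le_mul_of_nonneg_right hG0 he0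
  have hAB : |A * B| ≤ 12.08 * e * G := by
    rw [E3', abs_le]; constructor <;> linarith
  -- `A² ≲ 85.06 η² G`
  have hAB2 : (A * B) ^ 2 ≤ (12.08 * e * G) ^ 2 :=
    sq_le_sq' (abs_le.mp hAB).1 (abs_le.mp hAB).2
  have hA2G : A * A * (1.7158 * G) ≤ A * A * (B * B) :=
    mul_le_mul_of_nonneg_left hB2 (mul_self_nonneg A)
  have hA2 : A * A * 1.7158 ≤ 145.9264 * e ^ 2 * G := by
    refine le_of_mul_le_mul_right ?_ hGpos
    linarith [hAB2, hA2G]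
  -- conclusion
  have heG2 : 0.736 * (e * e) ≤ G * (e * e) := mul_le_mul_of_nonneg_right hG0 (mul_self_nonneg e)
  have hfin : G * S2 ≤ G * (121 * e ^ 2) := by rw [E1']; linarith
  exact le_of_mul_le_mul_left hfin hGpos

/-- The equator step: once `s = a₁ + a₃` is short, the cap height is pinned,
`|4‖v‖² - 2| ≤ 29 η`. [folklore] -/
theorem oct_solve_H {e H S2 p₂ t g g' : ℝ} (he0 : 0 ≤ e) (he : e ≤ 1 / 1000) (hH : 0.429 ≤ H)
    (hS20 : 0 ≤ S2) (hS2 : S2 ≤ 121 * e ^ 2) (hp₂0 : 0 ≤ p₂) (hp₂ : p₂ + H ≤ (1 + e) ^ 2)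
    (ht : t = g + g')
    (hCS : t * t ≤ S2 * p₂)
    (hg1 : 1 - 6 * e + e ^ 2 - 2 * H ≤ 2 * g) (hg2 : 2 * g ≤ 1 + 6 * e + e ^ 2 - 2 * H)
    (hg1' : 1 - 6 * e + e ^ 2 - 2 * H ≤ 2 * g') (hg2' : 2 * g' ≤ 1 + 6 * e + e ^ 2 - 2 * H) :
    |4 * H - 2| ≤ 29 * e := by
  have he2 : e * e ≤ 1 / 1000 * e := mul_le_mul_of_nonneg_right he he0
  have hp₂' : p₂ ≤ 0.5731 := by linarith
  have h1 : S2 * p₂ ≤ 121 * e ^ 2 * p₂ := mul_le_mul_of_nonneg_right hS2 hp₂0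
  have h2 : 121 * e ^ 2 * p₂ ≤ 121 * e ^ 2 * 0.5731 :=
    mul_le_mul_of_nonneg_left hp₂' (by positivity)
  have ht2 : t ^ 2 ≤ (8.4 * e) ^ 2 := by linarith
  obtain ⟨ht1, ht2⟩ := abs_le_of_sq_le_sq' ht2 (by positivity)
  rw [abs_le]; constructor <;> linarith

/-- The diagonal step: `‖a₁ - a₃‖² = 2‖a₁‖² + 2‖a₃‖² - ‖a₁ + a₃‖²` is pinned to `2 ± 38 η`.
[folklore] -/
theorem oct_solve_D {e H S2 p₁ p₃ P : ℝ} (he0 : 0 ≤ e) (he : e ≤ 1 / 1000)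
    (hH : |4 * H - 2| ≤ 29 * e) (hS20 : 0 ≤ S2) (hS2 : S2 ≤ 121 * e ^ 2)
    (hp₁ : (1 - e) ^ 2 ≤ p₁ + H) (hp₁' : p₁ + H ≤ (1 + e) ^ 2)
    (hp₃ : (1 - e) ^ 2 ≤ p₃ + H) (hp₃' : p₃ + H ≤ (1 + e) ^ 2)
    (hP : P = 2 * p₁ + 2 * p₃ - S2) :
    P - 2 ≤ 38 * e ∧ 2 - P ≤ 38 * e := by
  have he2 : e * e ≤ 1 / 1000 * e := mul_le_mul_of_nonneg_right he he0
  obtain ⟨hH1, hH2⟩ := abs_le.mp hH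
  constructor <;> linarith

/-- From a two-sided bound on `L² - 2` to `|L - √2| ≤ 30 η` (for `L ≥ 1.31`). [folklore] -/
theorem oct_abs_sub_sqrt_two_le {e L : ℝ} (he0 : 0 ≤ e) (hL : 131 / 100 ≤ L)
    (h1 : L ^ 2 - 2 ≤ 38 * e) (h2 : 2 - L ^ 2 ≤ 38 * e) : |L - Real.sqrt 2| ≤ 30 * e := by
  have hs0 : 0 ≤ Real.sqrt 2 := Real.sqrt_nonneg 2
  have hs2 : Real.sqrt 2 ^ 2 = 2 := Real.sq_sqrt (by norm_num)
  have hs1 : 1.41 ≤ Real.sqrt 2 := by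
    rw [show (1.41 : ℝ) = Real.sqrt (1.41 ^ 2) by rw [Real.sqrt_sq]; norm_num]
    exact Real.sqrt_le_sqrt (by norm_num)
  have key : (L - Real.sqrt 2) * (L + Real.sqrt 2) = L ^ 2 - 2 := by nlinarith
  rw [abs_le]
  constructor
  · by_contra h
    rw [not_le] at h
    nlinarith [mul_le_mul_of_nonneg_left (show 2.72 ≤ L + Real.sqrt 2 by linarith) he0]
  · by_contra h
    rw [not_le] at h
    nlinarith [mul_le_mul_of_nonneg_left (show 2.72 ≤ L + Real.sqrt 2 by linarith) he0]

/-- **Three-dimensionality, frame form.** For `a b : ℝ³` there is a vector `m` (the cross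
product `a × b`) such that the Gram bilinear identity
`(‖a‖²‖b‖² - ⟪a,b⟫²) ⟪x,x'⟫ = ⟪x,m⟫⟪x',m⟫ + ‖a‖² ⟪x,b⟫⟪x',b⟫ - ⟪a,b⟫ (⟪x,b⟫⟪x',a⟫ + ⟪x,a⟫⟪x',b⟫)`
`  + ‖b‖² ⟪x,a⟫⟪x',a⟫`
holds for all `x x'` (Lagrange's identity for `x × (a × b)`, polarised: the orthogonal expansion
in the frame `(a, b, a × b)`, i.e. the only place where `dim = 3` is used). Proved in coordinates.
[folklore] -/
theorem oct_frame3 (a b : EuclideanSpace ℝ (Fin 3)) :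
    ∃ m : EuclideanSpace ℝ (Fin 3), ∀ x x' : EuclideanSpace ℝ (Fin 3),
    (⟪a, a⟫ * ⟪b, b⟫ - ⟪a, b⟫ ^ 2) * ⟪x, x'⟫ =
      ⟪x, m⟫ * ⟪x', m⟫ + ⟪a, a⟫ * (⟪x, b⟫ * ⟪x', b⟫)
        - ⟪a, b⟫ * (⟪x, b⟫ * ⟪x', a⟫ + ⟪x, a⟫ * ⟪x', b⟫) + ⟪b, b⟫ * (⟪x, a⟫ * ⟪x', a⟫) := by
  refine ⟨!₂[a 1 * b 2 - a 2 * b 1, a 2 * b 0 - a 0 * b 2, a 0 * b 1 - a 1 * b 0], ?_⟩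
  intro x x'
  simp only [PiLp.inner_apply, RCLike.inner_apply, conj_trivial, Fin.sum_univ_three,
    Matrix.cons_val_zero, Matrix.cons_val_one, Matrix.cons_val_two, Matrix.head_cons,
    Matrix.tail_cons]
  ring

/-- Apex edges: if `‖a + v‖, ‖a - v‖ ∈ [1-η, 1+η]` then `|⟪a,v⟫| ≤ η` and
`‖a‖² + ‖v‖² ∈ [(1-η)², (1+η)²]`. [folklore] -/
theorem oct_apex {e : ℝ} {a v : EuclideanSpace ℝ (Fin 3)} (he1 : e ≤ 1) (h1 : 1 - e ≤ ‖a + v‖)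
    (h2 : ‖a + v‖ ≤ 1 + e) (h3 : 1 - e ≤ ‖a - v‖) (h4 : ‖a - v‖ ≤ 1 + e) :
    |⟪a, v⟫| ≤ e ∧ (1 - e) ^ 2 ≤ ⟪a, a⟫ + ⟪v, v⟫ ∧ ⟪a, a⟫ + ⟪v, v⟫ ≤ (1 + e) ^ 2 := by
  have s1 := norm_add_sq_real a v
  have s2 := norm_sub_sq_real a v
  rw [← real_inner_self_eq_norm_sq a, ← real_inner_self_eq_norm_sq v] at s1 s2
  have h1' := pow_le_pow_left₀ (by linarith) h1 2
  have h2' := pow_le_pow_left₀ (norm_nonneg _) h2 2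
  have h3' := pow_le_pow_left₀ (by linarith) h3 2
  have h4' := pow_le_pow_left₀ (norm_nonneg _) h4 2
  exact ⟨abs_le.mpr ⟨by linarith, by linarith⟩, by linarith, by linarith⟩

/-- Equator edges: if `‖a - b‖ ∈ [1-η, 1+η]` then `‖a‖² + ‖b‖² - 2⟪a,b⟫ ∈ [(1-η)², (1+η)²]`.
[folklore] -/
theorem oct_edge {e : ℝ} {a b : EuclideanSpace ℝ (Fin 3)} (he1 : e ≤ 1) (h1 : 1 - e ≤ ‖a - b‖)
    (h2 : ‖a - b‖ ≤ 1 + e) :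
    (1 - e) ^ 2 ≤ ⟪a, a⟫ + ⟪b, b⟫ - 2 * ⟪a, b⟫ ∧ ⟪a, a⟫ + ⟪b, b⟫ - 2 * ⟪a, b⟫ ≤ (1 + e) ^ 2 := by
  have s2 := norm_sub_sq_real a b
  rw [← real_inner_self_eq_norm_sq a, ← real_inner_self_eq_norm_sq b] at s2
  have h1' := pow_le_pow_left₀ (by linarith) h1 2
  have h2' := pow_le_pow_left₀ (norm_nonneg _) h2 2
  exact ⟨by linarith, by linarith⟩

/-- **Soft unit octahedron, vector form.** With `v` the half-axis (`u = c - v`, `w = c + v`) and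
`aᵢ = zᵢ - c` the equator relative to the centre `c`: twelve soft edges and the three gaps force
`|‖a₁ - a₃‖ - √2| ≤ 30η` and `|2‖v‖ - √2| ≤ 30η`. [folklore] -/
theorem oct_core13v (e : ℝ) (a₁ a₂ a₃ a₄ v : EuclideanSpace ℝ (Fin 3)) (he0 : 0 ≤ e)
    (he : e ≤ 1 / 1000)
    (hu₁ : 1 - e ≤ ‖a₁ + v‖) (hu₁' : ‖a₁ + v‖ ≤ 1 + e)
    (hu₂ : 1 - e ≤ ‖a₂ + v‖) (hu₂' : ‖a₂ + v‖ ≤ 1 + e)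
    (hu₃ : 1 - e ≤ ‖a₃ + v‖) (hu₃' : ‖a₃ + v‖ ≤ 1 + e)
    (hu₄ : 1 - e ≤ ‖a₄ + v‖) (hu₄' : ‖a₄ + v‖ ≤ 1 + e)
    (hw₁ : 1 - e ≤ ‖a₁ - v‖) (hw₁' : ‖a₁ - v‖ ≤ 1 + e)
    (hw₂ : 1 - e ≤ ‖a₂ - v‖) (hw₂' : ‖a₂ - v‖ ≤ 1 + e)
    (hw₃ : 1 - e ≤ ‖a₃ - v‖) (hw₃' : ‖a₃ - v‖ ≤ 1 + e)
    (hw₄ : 1 - e ≤ ‖a₄ - v‖) (hw₄' : ‖a₄ - v‖ ≤ 1 + e)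
    (h₁₂ : 1 - e ≤ ‖a₁ - a₂‖) (h₁₂' : ‖a₁ - a₂‖ ≤ 1 + e)
    (h₂₃ : 1 - e ≤ ‖a₂ - a₃‖) (h₂₃' : ‖a₂ - a₃‖ ≤ 1 + e)
    (h₃₄ : 1 - e ≤ ‖a₃ - a₄‖) (h₃₄' : ‖a₃ - a₄‖ ≤ 1 + e)
    (h₄₁ : 1 - e ≤ ‖a₄ - a₁‖) (h₄₁' : ‖a₄ - a₁‖ ≤ 1 + e)
    (hd : 131 / 100 ≤ ‖a₁ - a₃‖) (hd' : 131 / 100 ≤ ‖a₂ - a₄‖) (hL : 131 / 100 ≤ 2 * ‖v‖) :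
    |‖a₁ - a₃‖ - Real.sqrt 2| ≤ 30 * e ∧ |2 * ‖v‖ - Real.sqrt 2| ≤ 30 * e := by
  have he1 : e ≤ 1 := by linarith
  have he2 : e * e ≤ 1 / 1000 * e := mul_le_mul_of_nonneg_right he he0
  -- scalar consequences of the twelve soft edges
  obtain ⟨q₁, p₁, p₁'⟩ := oct_apex he1 hu₁ hu₁' hw₁ hw₁'
  obtain ⟨q₂, p₂, p₂'⟩ := oct_apex he1 hu₂ hu₂' hw₂ hw₂'
  obtain ⟨q₃, p₃, p₃'⟩ := oct_apex he1 hu₃ hu₃' hw₃ hw₃'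
  obtain ⟨q₄, p₄, p₄'⟩ := oct_apex he1 hu₄ hu₄' hw₄ hw₄'
  obtain ⟨g₁₂, g₁₂'⟩ := oct_edge he1 h₁₂ h₁₂'
  obtain ⟨g₂₃, g₂₃'⟩ := oct_edge he1 h₂₃ h₂₃'
  obtain ⟨g₃₄, g₃₄'⟩ := oct_edge he1 h₃₄ h₃₄'
  obtain ⟨g₄₁, g₄₁'⟩ := oct_edge he1 h₄₁ h₄₁'
  have hn₁ : 0 ≤ ⟪a₁, a₁⟫ := real_inner_self_nonneg
  have hn₂ : 0 ≤ ⟪a₂, a₂⟫ := real_inner_self_nonneg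
  have hS20 : 0 ≤ ⟪a₁ + a₃, a₁ + a₃⟫ := real_inner_self_nonneg
  -- the three gaps, squared
  have hH4 : 1.7161 ≤ 4 * ⟪v, v⟫ := by
    have := pow_le_pow_left₀ (by norm_num) hL 2
    rw [mul_pow, ← real_inner_self_eq_norm_sq] at this; linarith
  have hP : 1.7161 ≤ ⟪a₁ - a₃, a₁ - a₃⟫ := by
    have := pow_le_pow_left₀ (by norm_num) hd 2
    rw [← real_inner_self_eq_norm_sq] at this; linarith
  have hP' : 1.7161 ≤ ⟪a₂ - a₄, a₂ - a₄⟫ := by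
    have := pow_le_pow_left₀ (by norm_num) hd' 2
    rw [← real_inner_self_eq_norm_sq] at this; linarith
  have hH0 : 0.429 ≤ ⟪v, v⟫ := by linarith
  have hH1 : ⟪v, v⟫ ≤ 1.003 := by linarith
  -- Gram entries of `s = a₁ + a₃`, `D = a₁ - a₃`, `D' = a₂ - a₄`
  have xSS : ⟪a₁ + a₃, a₁ + a₃⟫ = ⟪a₁, a₁⟫ + ⟪a₃, a₃⟫ + 2 * ⟪a₁, a₃⟫ := by
    simp only [inner_add_left, inner_add_right]; rw [real_inner_comm a₁ a₃]; ring
  have xP : ⟪a₁ - a₃, a₁ - a₃⟫ = ⟪a₁, a₁⟫ + ⟪a₃, a₃⟫ - 2 * ⟪a₁, a₃⟫ := by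
    simp only [inner_sub_left, inner_sub_right]; rw [real_inner_comm a₁ a₃]; ring
  have hP2 : ⟪a₁ - a₃, a₁ - a₃⟫ ≤ 2.3 := by linarith
  have bsD : |⟪a₁ + a₃, a₁ - a₃⟫| ≤ 4 * e := by
    have : ⟪a₁ + a₃, a₁ - a₃⟫ = ⟪a₁, a₁⟫ - ⟪a₃, a₃⟫ := by
      simp only [inner_add_left, inner_sub_right]; rw [real_inner_comm a₁ a₃]; ring
    rw [this, abs_le]; constructor <;> linarith
  have bsv : |⟪a₁ + a₃, v⟫| ≤ 2 * e := by
    rw [inner_add_left]; exact (abs_add_le _ _).trans (by linarith)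
  have bvD : |⟪v, a₁ - a₃⟫| ≤ 2 * e := by
    rw [inner_sub_right, real_inner_comm a₁ v, real_inner_comm a₃ v]
    exact (abs_sub _ _).trans (by linarith)
  have bD'v : |⟪a₂ - a₄, v⟫| ≤ 2 * e := by
    rw [inner_sub_left]; exact (abs_sub _ _).trans (by linarith)
  have bσ : |⟪a₁ + a₃, a₂ - a₄⟫| ≤ 12 * e := by
    have : ⟪a₁ + a₃, a₂ - a₄⟫ = ⟪a₁, a₂⟫ - ⟪a₄, a₁⟫ + ⟪a₂, a₃⟫ - ⟪a₃, a₄⟫ := by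
      simp only [inner_add_left, inner_sub_right]
      rw [real_inner_comm a₂ a₃, real_inner_comm a₄ a₁]; ring
    rw [this, abs_le]; constructor <;> linarith
  have bτ : |⟪a₂ - a₄, a₁ - a₃⟫| ≤ 12 * e := by
    have : ⟪a₂ - a₄, a₁ - a₃⟫ = ⟪a₁, a₂⟫ - ⟪a₂, a₃⟫ - ⟪a₄, a₁⟫ + ⟪a₃, a₄⟫ := by
      simp only [inner_sub_left, inner_sub_right]
      rw [real_inner_comm a₁ a₂, real_inner_comm a₃ a₄]; ring
    rw [this, abs_le]; constructor <;> linarith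
  -- three-dimensionality: `s` is short
  obtain ⟨m, hm⟩ := oct_frame3 v (a₁ - a₃)
  have hE1 := hm (a₁ + a₃) (a₁ + a₃)
  have hE2 := hm (a₂ - a₄) (a₂ - a₄)
  have hE3 := hm (a₁ + a₃) (a₂ - a₄)
  have hS2 : ⟪a₁ + a₃, a₁ + a₃⟫ ≤ 121 * e ^ 2 :=
    oct_solve_frame he0 he hH0 hH1 hP hP2 hP' bsD bsv bvD bD'v bσ bτ hE1 hE2 hE3
  -- the cap height
  have ht : ⟪a₁ + a₃, a₂⟫ = ⟪a₁, a₂⟫ + ⟪a₂, a₃⟫ := by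
    rw [inner_add_left, real_inner_comm a₂ a₃]
  have hH : |4 * ⟪v, v⟫ - 2| ≤ 29 * e :=
    oct_solve_H he0 he hH0 hS20 hS2 hn₂ p₂' ht (real_inner_mul_inner_self_le _ _)
      (by linarith) (by linarith) (by linarith) (by linarith)
  obtain ⟨hH₁, hH₂⟩ := abs_le.mp hH
  -- the diagonal
  obtain ⟨hD₁, hD₂⟩ := oct_solve_D he0 he hH hS20 hS2 p₁ p₁' p₃ p₃'
    (show ⟪a₁ - a₃, a₁ - a₃⟫ = 2 * ⟪a₁, a₁⟫ + 2 * ⟪a₃, a₃⟫ - ⟪a₁ + a₃, a₁ + a₃⟫ by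
      rw [xSS, xP]; ring)
  rw [real_inner_self_eq_norm_sq] at hD₁ hD₂
  refine ⟨oct_abs_sub_sqrt_two_le he0 hd hD₁ hD₂, oct_abs_sub_sqrt_two_le he0 hL ?_ ?_⟩
  · rw [mul_pow, ← real_inner_self_eq_norm_sq]; linarith
  · rw [mul_pow, ← real_inner_self_eq_norm_sq]; linarith

/-- **Soft unit octahedron, one diagonal and the axis.** Six points `u w z₁ z₂ z₃ z₄` spanning
the octahedral graph with its twelve edges in `[1-η, 1+η]` (`η ≤ 1/1000`) and the three diagonals
`≥ 1.31` have `|dist z₁ z₃ - √2| ≤ 30η` and `|dist u w - √2| ≤ 30η`. [folklore] -/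
theorem oct_core13 (η : ℝ) (u w z₁ z₂ z₃ z₄ : EuclideanSpace ℝ (Fin 3)) (hη0 : 0 ≤ η)
    (hη : η ≤ 1 / 1000)
    (hu₁ : 1 - η ≤ dist u z₁) (hu₁' : dist u z₁ ≤ 1 + η)
    (hu₂ : 1 - η ≤ dist u z₂) (hu₂' : dist u z₂ ≤ 1 + η)
    (hu₃ : 1 - η ≤ dist u z₃) (hu₃' : dist u z₃ ≤ 1 + η)
    (hu₄ : 1 - η ≤ dist u z₄) (hu₄' : dist u z₄ ≤ 1 + η)
    (hw₁ : 1 - η ≤ dist w z₁) (hw₁' : dist w z₁ ≤ 1 + η)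
    (hw₂ : 1 - η ≤ dist w z₂) (hw₂' : dist w z₂ ≤ 1 + η)
    (hw₃ : 1 - η ≤ dist w z₃) (hw₃' : dist w z₃ ≤ 1 + η)
    (hw₄ : 1 - η ≤ dist w z₄) (hw₄' : dist w z₄ ≤ 1 + η)
    (h₁₂ : 1 - η ≤ dist z₁ z₂) (h₁₂' : dist z₁ z₂ ≤ 1 + η)
    (h₂₃ : 1 - η ≤ dist z₂ z₃) (h₂₃' : dist z₂ z₃ ≤ 1 + η)
    (h₃₄ : 1 - η ≤ dist z₃ z₄) (h₃₄' : dist z₃ z₄ ≤ 1 + η)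
    (h₄₁ : 1 - η ≤ dist z₄ z₁) (h₄₁' : dist z₄ z₁ ≤ 1 + η)
    (hd : 131 / 100 ≤ dist z₁ z₃) (hd' : 131 / 100 ≤ dist z₂ z₄) (hL : 131 / 100 ≤ dist u w) :
    |dist z₁ z₃ - Real.sqrt 2| ≤ 30 * η ∧ |dist u w - Real.sqrt 2| ≤ 30 * η := by
  -- half-axis `v`, so that `w = u + 2v`
  obtain ⟨v, hv⟩ : ∃ v : EuclideanSpace ℝ (Fin 3), w - u = v + v :=
    ⟨(1 / 2 : ℝ) • (w - u), by rw [← add_smul]; norm_num⟩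
  obtain rfl : w = v + v + u := sub_eq_iff_eq_add.mp hv
  have Eu : ∀ z, dist u z = ‖(z - u - v) + v‖ := fun z => by
    rw [dist_comm, dist_eq_norm]; congr 1; abel
  have Ew : ∀ z, dist (v + v + u) z = ‖(z - u - v) - v‖ := fun z => by
    rw [dist_comm, dist_eq_norm]; congr 1; abel
  have Ez : ∀ z z', dist z z' = ‖(z - u - v) - (z' - u - v)‖ := fun z z' => by
    rw [dist_eq_norm]; congr 1; abel
  have Euw : dist u (v + v + u) = 2 * ‖v‖ := by
    rw [dist_comm, dist_eq_norm, add_sub_cancel_right, ← two_smul ℝ v, norm_smul,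
      Real.norm_eq_abs, abs_of_pos two_pos]
  rw [Eu z₁] at hu₁ hu₁'; rw [Eu z₂] at hu₂ hu₂'; rw [Eu z₃] at hu₃ hu₃'; rw [Eu z₄] at hu₄ hu₄'
  rw [Ew z₁] at hw₁ hw₁'; rw [Ew z₂] at hw₂ hw₂'; rw [Ew z₃] at hw₃ hw₃'; rw [Ew z₄] at hw₄ hw₄'
  rw [Ez z₁ z₂] at h₁₂ h₁₂'; rw [Ez z₂ z₃] at h₂₃ h₂₃'; rw [Ez z₃ z₄] at h₃₄ h₃₄'
  rw [Ez z₄ z₁] at h₄₁ h₄₁'; rw [Ez z₁ z₃] at hd ⊢; rw [Ez z₂ z₄] at hd'; rw [Euw] at hL ⊢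
  exact oct_core13v η (z₁ - u - v) (z₂ - u - v) (z₃ - u - v) (z₄ - u - v) v hη0 hη hu₁ hu₁'
    hu₂ hu₂' hu₃ hu₃' hu₄ hu₄' hw₁ hw₁' hw₂ hw₂' hw₃ hw₃' hw₄ hw₄' h₁₂ h₁₂' h₂₃ h₂₃' h₃₄ h₃₄'
    h₄₁ h₄₁' hd hd' hL

/-- **Soft unit octahedron lemma** (registered stub `stub_octahedron` of the line `birth` for
the crux `ZeroDefectDensity`, stmt-AtomisticToContinuum-12086). Six points `u w z₁ z₂ z₃ z₄ : ℝ³`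
spanning the octahedral graph (`u`, `w` joined to each `zᵢ`, and the 4-cycle `z₁z₂z₃z₄`) with
the twelve edges in `[1-η, 1+η]`, `0 ≤ η ≤ 1/1000`, and the three diagonals
`z₁z₃, z₂z₄, uw ≥ 1.31` have all three diagonals within `30η` of `√2`: the regular octahedron is
rigid to first order, so the jitterbug flex of the bare cuboctahedral shell is killed by its
caps. Proof: Apollonius for the apex edges, a cross-product (Gram) identity in `ℝ³` to show that
the midpoints of the two equator diagonals nearly coincide with the centre, then Cauchy–Schwarz
and the parallelogram law. [folklore] -/
theorem stub_octahedron : (∀ (η : ℝ) (u w z₁ z₂ z₃ z₄ : EuclideanSpace ℝ (Fin 3)), 0 ≤ η → η ≤ 1 / 1000 → 1 - η ≤ dist u z₁ → dist u z₁ ≤ 1 + η → 1 - η ≤ dist u z₂ → dist u z₂ ≤ 1 + η → 1 - η ≤ dist u z₃ → dist u z₃ ≤ 1 + η → 1 - η ≤ dist u z₄ → dist u z₄ ≤ 1 + η → 1 - η ≤ dist w z₁ → dist w z₁ ≤ 1 + η → 1 - η ≤ dist w z₂ → dist w z₂ ≤ 1 + η → 1 - η ≤ dist w z₃ → dist w z₃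 ≤ 1 + η → 1 - η ≤ dist w z₄ → dist w z₄ ≤ 1 + η → 1 - η ≤ dist z₁ z₂ → dist z₁ z₂ ≤ 1 + η → 1 - η ≤ dist z₂ z₃ → dist z₂ z₃ ≤ 1 + η → 1 - η ≤ dist z₃ z₄ → dist z₃ z₄ ≤ 1 + η → 1 - η ≤ dist z₄ z₁ → dist z₄ z₁ ≤ 1 + η → 131 / 100 ≤ dist z₁ z₃ → 131 / 100 ≤ dist z₂ z₄ → 131 / 100 ≤ dist u w → |dist z₁ z₃ - Real.sqrt 2| ≤ 30 * η ∧ |dist z₂ z₄ - Real.sqrt 2| ≤ 30 * η ∧ |dist u w - Real.sqrt 2| ≤ 30 * η) := by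
  intro η u w z₁ z₂ z₃ z₄ hη0 hη hu₁ hu₁' hu₂ hu₂' hu₃ hu₃' hu₄ hu₄' hw₁ hw₁' hw₂ hw₂' hw₃ hw₃'
    hw₄ hw₄' h₁₂ h₁₂' h₂₃ h₂₃' h₃₄ h₃₄' h₄₁ h₄₁' hd hd' hL
  have A := oct_core13 η u w z₁ z₂ z₃ z₄ hη0 hη hu₁ hu₁' hu₂ hu₂' hu₃ hu₃' hu₄ hu₄' hw₁ hw₁'
    hw₂ hw₂' hw₃ hw₃' hw₄ hw₄' h₁₂ h₁₂' h₂₃ h₂₃' h₃₄ h₃₄' h₄₁ h₄₁' hd hd' hL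
  have B := oct_core13 η u w z₂ z₃ z₄ z₁ hη0 hη hu₂ hu₂' hu₃ hu₃' hu₄ hu₄' hu₁ hu₁' hw₂ hw₂'
    hw₃ hw₃' hw₄ hw₄' hw₁ hw₁' h₂₃ h₂₃' h₃₄ h₃₄' h₄₁ h₄₁' h₁₂ h₁₂' hd' (by rwa [dist_comm]) hL
  exact ⟨A.1, B.1, A.2⟩

end Summit.AtomisticToContinuum.Crystallization.Theorems.ZeroDefectDensityBirth
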